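import Summits.QuantumFields.YangMills.Theorems.BalabanUVNodesSpineRates
import Summits.QuantumFields.BalabanUV.T4Continuum.Spine.NE9.TowerCarriers
import Literature.MathematicalPhysics.QuantumFieldTheory.Balaban1983to89.Node00.RateRecord11
import Literature.MathematicalPhysics.QuantumFieldTheory.Balaban1983to89.Node00.Record11DatumKey

/-!
# THE RATE-CARRIER PREDICATE OF RECORD AT NODE 00's STAGE 11 — layer B of the RATE-RECORD HOME: `YMDAG.UVSplit.RRec₁₁ 𝔯 : RateRecordPred N`,
# KEYED BY THE DATUM (`Node00.IsDatumOfRecord₁₁C F N D`, canonical parameter `h.params`) to the rate objects of RR-1's layer A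
# (`Node00/RateRecord11.lean`, p455395): the bundle of run length `k` at `(F, D, g₀, os)` IS `rateCarriersOfRecord₁₁ 𝔯 F h.params g₀ os k` — node U3's LEVEL-`k`
# bundle of ONE object tower with the K-uniform letter block, window `]0, θ.γ]` — and the ONE-APPLICATION faces of the K4 stubs `S_N14 … S_N22`, `S_D4`, `S_R00x`

Track A of `YM-PLAN.md` (cell `pub-ymgap`, HUMAN RULING D-0062).  The (T-RATE) file of dag-lead's DIVISION WORDS-99 ∕ WORDS-101 (pub-ymgap INBOX l.≈12195 ∕
l.≈12393, 2026-08-26): «(N) layer A `Node00/RateRecord11.lean` = node00-def-RR-1 (containers + readings, Literature-typed) · the ONE Stage-11 KEY shared by both carrier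
records = node00-def-RR-2's `Node00/Record11DatumKey.lean` (`IsDatumOfRecord₁₁C F N D` with `.params ∕ .provisos`) · (T-RATE) THIS FILE = dag-n22-e (`RRec₁₁` + the
one-application faces) · (T-SPINE) `BalabanUVNodesSpineCarriersOfRecord11.lean` = dag-n20-e (`SRec₁₁`, p454411)».  File name: dag-lead's (T-RATE) name (RR-1's INTENT-1
calls the same file `…RateRecord11.lean`; ONE file).  Definition lane (one `structure`, five `def`s); every theorem is kernel bookkeeping over tree declarations BY NAME;
0 `sorry`, standard axioms.  COUNT-NEUTRAL; `--supports` the K3 item `SpineGivenEndpointR11` (stmt-QuantumFields-19676).  Restate-immune (no Theses import).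

THE DEFINITION (RR-2 PRE-READ §B «PINS ONLY», keyed per WORDS-101 (ii) through the DATUM KEY so that (T-SPINE) and (T-RATE) read their objects AT THE SAME
parameter — `Node00.keyed_canon₁₁_coherent`).  A RATE READING `𝔯 : RateReading₁₁ N` is the pair of RESIDUAL assignments the objects of record are read from:
`𝔯.lit : Node00.RateAssignment₁₁ N` (RR-1's Literature-typed objects per `(F, θ, g₀, os)`: node U3's `U3Objects₁₁` — level carriers, level functionals
`EA k ∕ EB k`, the K-UNIFORM letter block `κ θ₅ C₅ C₉ ω cr ρ` — and the single-scale layers `ne3 k`, `ne2 k`) and `𝔯.ne1` (N14's dressed tower of the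
observable-attached run — `NE1pCarriers`, Summits-typed, hence not in layer A).  The bundle of RUN LENGTH `k` is
`rateCarriersOfRecord₁₁ 𝔯 F θ g₀ os k := ⟨𝔯.ne1 F θ g₀ os, ne2OfRecord₁₁ ((𝔯.lit F θ g₀ os).ne2 k), ne3OfRecord₁₁ F ((𝔯.lit F θ g₀ os).ne3 k), u3OfRecord₁₁ θ (𝔯.lit F θ g₀ os).u3 k⟩`
with `u3OfRecord₁₁ θ u k := ⟨u.levelCarriers k, Window θ.γ, θ.γ, u.κ, u.EA k, u.EB k, u.θ₅, u.C₅, u.moduli, u.C₉, u.ω, u.cr, u.ρ⟩` (dag-n22-e DESIGN-INPUT (H2)–(H4),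
ADOPTED by RR-1: ONE tower per construction, bundles = its levels, run B's first coupling through `prependCoupling = prepend`, window `]0, θ.γ]`, letters NOT functions of
`k`), and the predicate is
`RRec₁₁ 𝔯 F D g₀ os R :↔ ∃ (h : Node00.IsDatumOfRecord₁₁C F N D) (k : ℕ), R = rateCarriersOfRecord₁₁ 𝔯 F h.params g₀ os k`.

WHAT THIS MODULE PROVES (all bookkeeping).
* §0 the Summits-side bridges of layer A: `towerData₁₁` (`U3Tower₁₁ ↦ TowerData`, fields), `towerData₁₁_level` (`rfl`), `prependCoupling_eq_prepend` (`funext; cases`),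
  `u3OfRecord₁₁_objects` (the bundle of a TOWER reading IS the literal `⟨(towerData₁₁ t).level k, Window θ.γ, θ.γ, κ, t.E k, fun b g U X => t.E (k+1) (prepend b g) U X, …⟩`
  the N22 ∕ N18 tower slots destructure — `YMDAG.N22.s_N22_of_towerSlot`, `…N22AtRecordTowerKeyed`, `YMDAG.N18.HLayer.s_N18_of_comap_congr`).
* §1 FACES of the bundle: `u3OfRecord₁₁_W ∕ _γ ∕ _Λ ∕ _C ∕ _EA ∕ _EB` (`rfl`), `fadingMemory_u3OfRecord₁₁` (**`FadingMemory` BY NAME from the letter signs** — the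
  moduli ARE `C₉·ω^{k−i}`), `n22At_u3OfRecord₁₁_iff` (under the signs, `N22At` at the bundle IS `NE9` alone).
* §2 FACES of the predicate: `rRec₁₁_iff` (`Iff.rfl`), `rRec₁₁_self`, `RRec₁₁.datumKey ∕ .stage11 ∕ .home ∕ .window ∕ .moduli ∕ .ne3_L ∕ .two_le_ne3_L`,
  `RRec₁₁.lower_level` (every LOWER level of the bundle's tower is again a bundle of record at the same datum — the TOWER KEY of `…N22AtRecordTowerKeyed`),
  `rRec₁₁_congr` (re-key tool: readings agreeing on admissible tuples with provisos key the same predicate), `exists_rRec₁₁_of_isRecordOfRecord₁₁C`.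
* §3 THE ONE-APPLICATION INSTANCES: `s_N14 ∕ s_N15 ∕ s_N16 ∕ s_N17 ∕ s_N18 ∕ s_N22 ∕ s_D4_rRec₁₁_iff` — each stub at `RRec₁₁ 𝔯` IS «for every family, every datum of
  record, every `g₀, os, k`: the node's estimate at the canonical objects» — and the θ-FORM transfer `forall_datumKey_of_forall_admissible` (what a consumer proves at
  EVERY admissible θ with provisos holds at every datum key: `Node00.IsDatumOfRecord₁₁C.forall_params`'s pattern); `rateInputs_rRec₁₁_iff` (K4's hook).
* §4 K4's EXISTENCE STUB PROVED OUTRIGHT and the K0 link: `s_R00x_rRec₁₁` (`S_R00x (fun F D w => Node00.IsRecordOfRecord₁₁C F N D w) (RRec₁₁ 𝔯)` — witness = level `0`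
  at the record's own datum key; existence is FREE precisely because the objects are residual: located, not content), `exists_pinned_rRec₁₁_of_inhabited`,
  `k4_rRec₁₁_of_uninhabited` (honesty: if NO datum of record exists at `N` — the negation of K0's body — the six antitone stubs hold WITH NO ESTIMATE).

HONEST FRAMING (binding; n14-d (R-1) per WORDS-101 (iii), verbatim in substance).  PINS ONLY; EVERY rate object is read from the RESIDUAL reading `𝔯` until a
definer PINS it by name (W1's `Node00/HistoryTermsOfRecord` → `u3`'s level functionals via `U3Objects₁₁.ofFixed`∕a `U3Tower₁₁`; N16's letters; N15's paired
instances; NODE O's dressed tower → `𝔯.ne1`) — so `S_N14 … S_N22 (RRec₁₁ 𝔯)` are statements ABOUT `𝔯`'s objects: contentful for a constructed `𝔯`, refutable for a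
junk `𝔯` (the consumers' `not_s_N1x_of_admits` guards stand); **a skeleton quoting `S_N14 (RRec₁₁ 𝔯)` NAMES its `𝔯`; there is no N14 discharge over a residual
dressed tower, and likewise for every node over a residual component.**  Nothing of Bałaban's is asserted or instantiated; NE1′ ∕ NE2 ∕ NE3 ∕ NE4 ∕ NE5 ∕ NE9 are
NOT PRINTED for d = 4 and NOT PROVED; no inhabitant of `IsDatumOfRecord₁₁C` is claimed (K0 open); no node is discharged (typed 28∕28, discharged count untouched); one
finite four-torus programme at fixed `ε`, Bałaban as printed — NOT ℝ⁴, NOT infinite volume, NOT OS, NOT a mass gap, NOT Clay.  No decl below carries a cite tag.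
-/

noncomputable section

namespace YMDAG.UVSplit

open Literature.MathematicalPhysics.QuantumFieldTheory.Balaban1983to89
open Literature.MathematicalPhysics.QuantumFieldTheory.Balaban1983to89.T4Continuum
open Literature.MathematicalPhysics.QuantumFieldTheory.Balaban1983to89.T4OutputRate (Carriers Functional Window NE9 FadingMemory)
open Summit.QuantumFields.BalabanUV.T4Continuum.NE9.TowerCarriers (TowerData prepend)
open Node00 (Stage11Params datumOfRecord₁₁ IsRecordOfRecord₁₁C IsDatumOfRecord₁₁C U3Letters₁₁ U3Objects₁₁ U3Tower₁₁ NE3Objects₁₁ NE2Objects₁₁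
  RateObjects₁₁ RateAssignment₁₁ prependCoupling ne3LOfRecord₁₁)

/-! ## §0 The Summits-side bridges of layer A: `U3Tower₁₁ ↦ TowerData`, `prependCoupling = prepend` -/

/-- The `TowerData` of an object tower (field for field). [bookkeeping] -/
def towerData₁₁ (t : U3Tower₁₁) : TowerData :=
  ⟨t.Dom, t.r, t.d, t.d_nonneg, t.B, t.gauge, t.gauge_nonneg, t.tr⟩

/-- Its level-`k` pair carriers ARE the object tower's level carriers (`rfl`). [bookkeeping] -/
theorem towerData₁₁_level (t : U3Tower₁₁) (k : ℕ) : (towerData₁₁ t).level k = t.levelCarriers k := rfl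

/-- Layer A's `prependCoupling` IS `Spine.NE9.TowerCarriers.prepend`. [bookkeeping] -/
theorem prependCoupling_eq_prepend : prependCoupling = prepend := by
  funext b g i
  cases i <;> rfl

variable {N : ℕ} [NeZero N]

/-! ## §1 Node U3's bundle of record at run length `k` and its faces -/

/-- **NODE U3's BUNDLE OF RECORD AT RUN LENGTH `k`** for Stage-11 parameters `θ` and U3 objects `u`: the level-`k` pair carriers, the window `]0, θ.γ]` with radius
`θ.γ`, the level functional `u.EA k` and run B's first-coupling family `u.EB k`, and the K-UNIFORM letter block with the geometric moduli `u.moduli k i = C₉·ω^{k−i}`. -/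
def u3OfRecord₁₁ {F : T4Family} (θ : Stage11Params F N) (u : U3Objects₁₁) (k : ℕ) : U3Carriers :=
  ⟨u.levelCarriers k, Window θ.γ, θ.γ, u.κ, u.EA k, u.EB k, u.θ₅, u.C₅, u.moduli, u.C₉, u.ω, u.cr, u.ρ⟩

/-- N16's carriers of record from layer A's NE3 objects: the block factor is the family's (`ne3LOfRecord₁₁ F = F.L`). -/
def ne3OfRecord₁₁ (F : T4Family) (o : NE3Objects₁₁ N) : NE3Carriers N :=
  ⟨ne3LOfRecord₁₁ F, o.Nper, o.ε, o.b, o.g, o.C, o.Λ₁, o.Λ₂', o.dom⟩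

/-- N15's carriers of record from layer A's NE2 objects (field for field). -/
def ne2OfRecord₁₁ (o : NE2Objects₁₁) : NE2Carriers :=
  ⟨o.I, o.c35, o.p, o.pi, o.Kop, o.Ksite, o.Kunit, o.inΛ, o.unitDist⟩

/-- **A RATE READING**: the two RESIDUAL assignments the rate carriers of record are read from — RR-1's Literature-typed rate objects `lit` (node U3's object tower
and letter block, N16's and N15's single-scale layers per run length) and N14's dressed tower of the observable-attached run `ne1` (Summits-typed).  Parameters of
this file; pinned later BY NAME; no law assumed. -/
structure RateReading₁₁ (N : ℕ) [NeZero N] where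
  /-- RR-1's rate objects per `(F, θ, g₀, os)` -/
  lit : RateAssignment₁₁ N
  /-- N14's dressed-tower carriers per `(F, θ, g₀, os)` -/
  ne1 : (F : T4Family) → Stage11Params F N → (ℕ → ℝ) → List (ULoop F) → NE1pCarriers

/-- **THE RATE-CARRIER BUNDLE OF RECORD AT RUN LENGTH `k`** read from `𝔯` at `(F, θ, g₀, os)`. -/
def rateCarriersOfRecord₁₁ (𝔯 : RateReading₁₁ N) (F : T4Family) (θ : Stage11Params F N) (g₀ : ℕ → ℝ) (os : List (ULoop F)) (k : ℕ) :
    RateCarriers N :=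
  ⟨𝔯.ne1 F θ g₀ os, ne2OfRecord₁₁ ((𝔯.lit F θ g₀ os).ne2 k), ne3OfRecord₁₁ F ((𝔯.lit F θ g₀ os).ne3 k), u3OfRecord₁₁ θ (𝔯.lit F θ g₀ os).u3 k⟩

/-- **THE RATE-CARRIER PREDICATE OF RECORD, STAGE 11, KEYED BY THE DATUM**: at `(F, D, g₀, os)` it pins exactly the bundles of every run length `k` read from `𝔯` at
the CANONICAL Stage-11 parameter `h.params` of the datum of record `D` (`h : Node00.IsDatumOfRecord₁₁C F N D` — a proposition: proof-irrelevant, one parameter). -/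
def RRec₁₁ (𝔯 : RateReading₁₁ N) : RateRecordPred N :=
  fun F D g₀ os R => ∃ (h : IsDatumOfRecord₁₁C F N D) (k : ℕ), R = rateCarriersOfRecord₁₁ 𝔯 F h.params g₀ os k

section BundleFaces

variable {F : T4Family} (θ : Stage11Params F N) (u : U3Objects₁₁) (k : ℕ)

/-- The window of the bundle is `]0, θ.γ]` (`rfl`). -/
theorem u3OfRecord₁₁_W : (u3OfRecord₁₁ θ u k).W = Window (u3OfRecord₁₁ θ u k).γ := rfl

/-- Its radius is `θ.γ` (`rfl`). -/
theorem u3OfRecord₁₁_γ : (u3OfRecord₁₁ θ u k).γ = θ.γ := rfl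

/-- Its carriers are the level-`k` carriers (`rfl`). -/
theorem u3OfRecord₁₁_C : (u3OfRecord₁₁ θ u k).C = u.levelCarriers k := rfl

/-- Its run-A functional is the level functional (`rfl`). -/
theorem u3OfRecord₁₁_EA : (u3OfRecord₁₁ θ u k).EA = u.EA k := rfl

/-- Its run-B family is the level family (`rfl`). -/
theorem u3OfRecord₁₁_EB : (u3OfRecord₁₁ θ u k).EB = u.EB k := rfl

/-- Its history moduli ARE `C₉·ω^{a−i}` (the analytic-slot shape `R.u3.Λ = fun a i => R.u3.C₉ * R.u3.ω ^ (a - i)`, `rfl`). -/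
theorem u3OfRecord₁₁_Λ : (u3OfRecord₁₁ θ u k).Λ = fun a i => (u3OfRecord₁₁ θ u k).C₉ * (u3OfRecord₁₁ θ u k).ω ^ (a - i) := rfl

/-- **`FadingMemory` BY NAME FROM THE LETTER SIGNS**: the bundle's moduli are `C₉·ω^{k−i}` by construction, so under the displayed signs (`0 ≤ C₉`, `0 ≤ ω`) the
fading-memory half of `N22At` holds at EVERY level with NO estimate. -/
theorem fadingMemory_u3OfRecord₁₁ (hs : u.Signs) :
    FadingMemory (u3OfRecord₁₁ θ u k).C₉ (u3OfRecord₁₁ θ u k).ω (u3OfRecord₁₁ θ u k).Λ :=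
  fun a i _ => ⟨hs.moduli_nonneg a i, le_rfl⟩

/-- **UNDER THE SIGNS, `N22At` AT THE BUNDLE IS `NE9` ALONE** — the joint history-Lipschitz bound of the level functional on `]0, θ.γ]` with the moduli of record. -/
theorem n22At_u3OfRecord₁₁_iff (hs : u.Signs) :
    N22At (u3OfRecord₁₁ θ u k) ↔ NE9 (u.EA k) (Window θ.γ) u.κ u.moduli :=
  ⟨fun h => h.1, fun h => ⟨h, fadingMemory_u3OfRecord₁₁ θ u k hs⟩⟩

/-- **THE BUNDLE OF A TOWER READING IS THE TOWER-SLOT LITERAL**: for an object tower `t` with letter block `ℓ`,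
`u3OfRecord₁₁ θ (t.objects ℓ) k = ⟨(towerData₁₁ t).level k, Window θ.γ, θ.γ, ℓ.κ, t.E k, fun b g U X => t.E (k+1) (prepend b g) U X, ℓ.θ₅, ℓ.C₅, fun a i => ℓ.C₉·ℓ.ω^(a−i), ℓ.C₉, ℓ.ω, ℓ.cr, ℓ.ρ⟩`
— the shape `YMDAG.N22.s_N22_of_towerSlot` ∕ `s_N22_of_s_N18_towerKeyed` ∕ `YMDAG.N18.HLayer.s_N18_of_comap_congr` destructure. -/
theorem u3OfRecord₁₁_objects (t : U3Tower₁₁) (ℓ : U3Letters₁₁) :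
    u3OfRecord₁₁ θ (t.objects ℓ) k =
      ⟨(towerData₁₁ t).level k, Window θ.γ, θ.γ, ℓ.κ, t.E k, fun b g U X => t.E (k + 1) (prepend b g) U X, ℓ.θ₅, ℓ.C₅,
        fun a i => ℓ.C₉ * ℓ.ω ^ (a - i), ℓ.C₉, ℓ.ω, ℓ.cr, ℓ.ρ⟩ := by
  have hEB : (fun (b : ℝ) (g : ℕ → ℝ) (U : t.B) (X : t.Dom) => t.E (k + 1) (prependCoupling b g) U X) =
      fun b g U X => t.E (k + 1) (prepend b g) U X := by
    funext b g U X
    rw [prependCoupling_eq_prepend]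
  exact congrArg (fun EB : ℝ → (ℕ → ℝ) → t.B → t.Dom → ℝ =>
    (⟨(towerData₁₁ t).level k, Window θ.γ, θ.γ, ℓ.κ, t.E k, EB, ℓ.θ₅, ℓ.C₅, fun a i => ℓ.C₉ * ℓ.ω ^ (a - i), ℓ.C₉, ℓ.ω, ℓ.cr, ℓ.ρ⟩ : U3Carriers)) hEB

end BundleFaces

variable (𝔯 : RateReading₁₁ N)

/-! ## §2 Faces of the predicate -/

/-- Unfolding (`Iff.rfl`). -/
theorem rRec₁₁_iff {F : T4Family} (D : Datum F N) (g₀ : ℕ → ℝ) (os : List (ULoop F)) (R : RateCarriers N) :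
    RRec₁₁ 𝔯 F D g₀ os R ↔ ∃ (h : IsDatumOfRecord₁₁C F N D) (k : ℕ), R = rateCarriersOfRecord₁₁ 𝔯 F h.params g₀ os k :=
  Iff.rfl

/-- **EVERY LEVEL OF THE READING AT A DATUM KEY IS PINNED AT THAT DATUM.** -/
theorem rRec₁₁_self {F : T4Family} {D : Datum F N} (h : IsDatumOfRecord₁₁C F N D) (g₀ : ℕ → ℝ) (os : List (ULoop F)) (k : ℕ) :
    RRec₁₁ 𝔯 F D g₀ os (rateCarriersOfRecord₁₁ 𝔯 F h.params g₀ os k) :=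
  ⟨h, k, rfl⟩

namespace RRec₁₁

variable {𝔯} {F : T4Family} {D : Datum F N} {g₀ : ℕ → ℝ} {os : List (ULoop F)} {R : RateCarriers N}

/-- The datum key and the run length behind a pinned bundle. -/
theorem datumKey (hR : RRec₁₁ 𝔯 F D g₀ os R) : ∃ (h : IsDatumOfRecord₁₁C F N D) (k : ℕ), R = rateCarriersOfRecord₁₁ 𝔯 F h.params g₀ os k := hR

/-- **TYPED OVER STAGE 11**: a pinned bundle comes with an admissible Stage-11 tuple with provisos realising the datum whose window bounds the bundle's radius
(`R.u3.γ ≤ θ.γ`, here `=`) — the first conjuncts of `…N17AtRecord9`-style slot closers at ₁₁. -/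
theorem stage11 (hR : RRec₁₁ 𝔯 F D g₀ os R) :
    ∃ (θ : Stage11Params F N) (hP : θ.Provisos₁₁), θ.Admissible ∧ D = datumOfRecord₁₁ F N θ hP ∧ R.u3.γ ≤ θ.γ := by
  obtain ⟨h, k, rfl⟩ := hR
  exact ⟨h.params, h.provisos, h.admissible, h.eq_datumOfRecord₁₁, le_rfl⟩

/-- **THE HOME-KEYING FACE FOR N17's ₁₁C CLOSERS**: a pinned bundle's datum is a Stage-11 record at a world whose window IS the bundle's radius
(`Node00.IsDatumOfRecord₁₁C.exists_world_gamma`). -/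
theorem home (hR : RRec₁₁ 𝔯 F D g₀ os R) : ∃ w : DagBinding.WorldP, IsRecordOfRecord₁₁C F N D w ∧ R.u3.γ = w.γ := by
  obtain ⟨h, k, rfl⟩ := hR
  obtain ⟨w, hw, hγ⟩ := h.exists_world_gamma
  exact ⟨w, hw, hγ.symm⟩

/-- The bundle's window IS `Window R.u3.γ` (the first conjunct of the N22 ∕ N18 slots). -/
theorem window (hR : RRec₁₁ 𝔯 F D g₀ os R) : R.u3.W = Window R.u3.γ := by
  obtain ⟨h, k, rfl⟩ := hR
  rfl

/-- The bundle's moduli ARE `C₉·ω^{k−i}` (the analytic-slot letter clause). -/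
theorem moduli (hR : RRec₁₁ 𝔯 F D g₀ os R) : R.u3.Λ = fun a i => R.u3.C₉ * R.u3.ω ^ (a - i) := by
  obtain ⟨h, k, rfl⟩ := hR
  rfl

/-- The bundle's radius is positive (`0 < θ.γ` from admissibility). -/
theorem gamma_pos (hR : RRec₁₁ 𝔯 F D g₀ os R) : 0 < R.u3.γ := by
  obtain ⟨h, k, rfl⟩ := hR
  exact h.gamma_pos

/-- N16 ∕ N21's block-factor clause: `R.ne3.L = F.L`. -/
theorem ne3_L (hR : RRec₁₁ 𝔯 F D g₀ os R) : R.ne3.L = F.L := by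
  obtain ⟨h, k, rfl⟩ := hR
  rfl

/-- … hence `2 ≤ R.ne3.L` (`Node00.two_le_ne3LOfRecord₁₁`). -/
theorem two_le_ne3_L (hR : RRec₁₁ 𝔯 F D g₀ os R) : 2 ≤ R.ne3.L := by
  obtain ⟨h, k, rfl⟩ := hR
  exact Node00.two_le_ne3LOfRecord₁₁ F

/-- **THE TOWER KEY — EVERY OTHER RUN LENGTH OF THE SAME READING IS AGAIN A BUNDLE OF RECORD AT THE SAME DATUM** (in particular every lower level; the clause
`YMDAG.N22.s_N22_of_s_N18_towerKeyed` consumes together with `S_N18 (RRec₁₁ 𝔯)`). -/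
theorem other_level (hR : RRec₁₁ 𝔯 F D g₀ os R) (k' : ℕ) :
    ∃ (h : IsDatumOfRecord₁₁C F N D), RRec₁₁ 𝔯 F D g₀ os (rateCarriersOfRecord₁₁ 𝔯 F h.params g₀ os k') := by
  obtain ⟨h, k, rfl⟩ := hR
  exact ⟨h, h, k', rfl⟩

end RRec₁₁

/-- **THE RE-KEY TOOL**: two readings that AGREE on the admissible tuples with provisos key the same predicate (so a definer's pin is ONE pointwise equation). -/
theorem rRec₁₁_congr {𝔯 𝔯' : RateReading₁₁ N}
    (hlit : ∀ (F : T4Family) (θ : Stage11Params F N), θ.Provisos₁₁ → θ.Admissible → ∀ (g₀ : ℕ → ℝ) (os : List (ULoop F)),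
      𝔯.lit F θ g₀ os = 𝔯'.lit F θ g₀ os)
    (hne1 : ∀ (F : T4Family) (θ : Stage11Params F N), θ.Provisos₁₁ → θ.Admissible → ∀ (g₀ : ℕ → ℝ) (os : List (ULoop F)),
      𝔯.ne1 F θ g₀ os = 𝔯'.ne1 F θ g₀ os)
    {F : T4Family} (D : Datum F N) (g₀ : ℕ → ℝ) (os : List (ULoop F)) (R : RateCarriers N) :
    RRec₁₁ 𝔯 F D g₀ os R ↔ RRec₁₁ 𝔯' F D g₀ os R := by
  have key : ∀ (h : IsDatumOfRecord₁₁C F N D) (k : ℕ),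
      rateCarriersOfRecord₁₁ 𝔯 F h.params g₀ os k = rateCarriersOfRecord₁₁ 𝔯' F h.params g₀ os k := fun h k => by
    unfold rateCarriersOfRecord₁₁
    rw [hlit F h.params h.provisos h.admissible g₀ os, hne1 F h.params h.provisos h.admissible g₀ os]
  constructor
  · rintro ⟨h, k, rfl⟩
    exact ⟨h, k, key h k⟩
  · rintro ⟨h, k, rfl⟩
    exact ⟨h, k, (key h k).symm⟩

/-- **AT A STAGE-11 RECORD PAIR** `(D, w)`: the datum is of record and every run length of the reading at its canonical parameter is pinned at `D`, for every `(g₀, os)`. -/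
theorem exists_rRec₁₁_of_isRecordOfRecord₁₁C {F : T4Family} {D : Datum F N} {w : DagBinding.WorldP} (hR : IsRecordOfRecord₁₁C F N D w) :
    ∃ h : IsDatumOfRecord₁₁C F N D, ∀ (g₀ : ℕ → ℝ) (os : List (ULoop F)) (k : ℕ),
      RRec₁₁ 𝔯 F D g₀ os (rateCarriersOfRecord₁₁ 𝔯 F h.params g₀ os k) :=
  ⟨Node00.isDatumOfRecord₁₁C_of_isRecordOfRecord₁₁C hR, fun g₀ os k => rRec₁₁_self 𝔯 _ g₀ os k⟩

/-! ## §3 The one-application instances of the K4 stubs at `RRec₁₁ 𝔯` -/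

/-- **THE θ-FORM TRANSFER**: a property of the reading's bundles established at EVERY admissible Stage-11 parameter with provisos holds at the canonical parameter of
every datum of record (how a consumer's ∀θ-theorem feeds the `iff`s below). -/
theorem forall_datumKey_of_forall_admissible
    {P : (F : T4Family) → Datum F N → Stage11Params F N → (ℕ → ℝ) → List (ULoop F) → ℕ → Prop}
    (hP : ∀ (F : T4Family) (θ : Stage11Params F N) (hθ : θ.Provisos₁₁), θ.Admissible →
      ∀ (g₀ : ℕ → ℝ) (os : List (ULoop F)) (k : ℕ), P F (datumOfRecord₁₁ F N θ hθ) θ g₀ os k)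
    (F : T4Family) (D : Datum F N) (h : IsDatumOfRecord₁₁C F N D) (g₀ : ℕ → ℝ) (os : List (ULoop F)) (k : ℕ) :
    P F D h.params g₀ os k := by
  have := hP F h.params h.provisos h.admissible g₀ os k
  rwa [← h.eq_datumOfRecord₁₁] at this

/-- **N14 at the home**: `S_N14 (RRec₁₁ 𝔯)` IS NE1′ at the dressed tower `𝔯.ne1` read at every datum key (CONTENTFUL ONLY FOR A NAMED `𝔯.ne1`). -/
theorem s_N14_rRec₁₁_iff : S_N14 (RRec₁₁ 𝔯) ↔ ∀ (F : T4Family) (D : Datum F N) (h : IsDatumOfRecord₁₁C F N D) (g₀ : ℕ → ℝ) (os : List (ULoop F)),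
    N14At (𝔯.ne1 F h.params g₀ os) := by
  constructor
  · intro hS F D h g₀ os
    exact hS F D g₀ os _ ⟨h, 0, rfl⟩
  · rintro hS F D g₀ os R ⟨h, k, rfl⟩
    exact hS F D h g₀ os

/-- **N15 at the home**: the three NE2⁺ layers at the level-`k` paired instances of the reading. -/
theorem s_N15_rRec₁₁_iff : S_N15 (RRec₁₁ 𝔯) ↔ ∀ (F : T4Family) (D : Datum F N) (h : IsDatumOfRecord₁₁C F N D) (g₀ : ℕ → ℝ) (os : List (ULoop F))
    (k : ℕ), N15At (ne2OfRecord₁₁ ((𝔯.lit F h.params g₀ os).ne2 k)) := by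
  constructor
  · intro hS F D h g₀ os k
    exact hS F D g₀ os _ ⟨h, k, rfl⟩
  · rintro hS F D g₀ os R ⟨h, k, rfl⟩
    exact hS F D h g₀ os k

/-- **N16 at the home**: NE3 at the level-`k` NE3 objects of the reading with the family's block factor. -/
theorem s_N16_rRec₁₁_iff : S_N16 (RRec₁₁ 𝔯) ↔ ∀ (F : T4Family) (D : Datum F N) (h : IsDatumOfRecord₁₁C F N D) (g₀ : ℕ → ℝ) (os : List (ULoop F))
    (k : ℕ), N16At (ne3OfRecord₁₁ F ((𝔯.lit F h.params g₀ os).ne3 k)) := by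
  constructor
  · intro hS F D h g₀ os k
    exact hS F D g₀ os _ ⟨h, k, rfl⟩
  · rintro hS F D g₀ os R ⟨h, k, rfl⟩
    exact hS F D h g₀ os k

/-- **N17 at the home**: NE4 ON THE DATUM at the dependent letters `(cr·C₅·θ₅, ρ, θ.γ)` of the reading's letter block (level-free: K-uniform letters). -/
theorem s_N17_rRec₁₁_iff : S_N17 (RRec₁₁ 𝔯) ↔ ∀ (F : T4Family) (D : Datum F N) (h : IsDatumOfRecord₁₁C F N D) (g₀ : ℕ → ℝ) (os : List (ULoop F))
    (k : ℕ), N17At D (u3OfRecord₁₁ h.params (𝔯.lit F h.params g₀ os).u3 k) := by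
  constructor
  · intro hS F D h g₀ os k
    exact hS F D g₀ os _ ⟨h, k, rfl⟩
  · rintro hS F D g₀ os R ⟨h, k, rfl⟩
    exact hS F D h g₀ os k

/-- **N18 at the home**: NE5 at EVERY level `k` of the reading's object tower, on `]0, θ.γ]`, at the letter block's `(κ, θ₅, C₅)`. -/
theorem s_N18_rRec₁₁_iff : S_N18 (RRec₁₁ 𝔯) ↔ ∀ (F : T4Family) (D : Datum F N) (h : IsDatumOfRecord₁₁C F N D) (g₀ : ℕ → ℝ) (os : List (ULoop F))
    (k : ℕ), N18At (u3OfRecord₁₁ h.params (𝔯.lit F h.params g₀ os).u3 k) := by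
  constructor
  · intro hS F D h g₀ os k
    exact hS F D g₀ os _ ⟨h, k, rfl⟩
  · rintro hS F D g₀ os R ⟨h, k, rfl⟩
    exact hS F D h g₀ os k

/-- **N22 at the home**: NE9 ∧ fading memory at EVERY level `k` of the reading's object tower — by `n22At_u3OfRecord₁₁_iff`, under the letter signs this is NE9 ALONE. -/
theorem s_N22_rRec₁₁_iff : S_N22 (RRec₁₁ 𝔯) ↔ ∀ (F : T4Family) (D : Datum F N) (h : IsDatumOfRecord₁₁C F N D) (g₀ : ℕ → ℝ) (os : List (ULoop F))
    (k : ℕ), N22At (u3OfRecord₁₁ h.params (𝔯.lit F h.params g₀ os).u3 k) := by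
  constructor
  · intro hS F D h g₀ os k
    exact hS F D g₀ os _ ⟨h, k, rfl⟩
  · rintro hS F D g₀ os R ⟨h, k, rfl⟩
    exact hS F D h g₀ os k

/-- **(D4) at the home**: the β-read-out binders on the datum at every level bundle. -/
theorem s_D4_rRec₁₁_iff : S_D4 (RRec₁₁ 𝔯) ↔ ∀ (F : T4Family) (D : Datum F N) (h : IsDatumOfRecord₁₁C F N D) (g₀ : ℕ → ℝ) (os : List (ULoop F))
    (k : ℕ), ReadOutAt D (u3OfRecord₁₁ h.params (𝔯.lit F h.params g₀ os).u3 k) := by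
  constructor
  · intro hS F D h g₀ os k
    exact hS F D g₀ os _ ⟨h, k, rfl⟩
  · rintro hS F D g₀ os R ⟨h, k, rfl⟩
    exact hS F D h g₀ os k

/-- **K4's HOOK AT THE HOME**: `RateInputs (RRec₁₁ 𝔯) F D g₀ os` IS «`D` is a datum of record and SOME run length of the reading carries the six in-edges of N19». -/
theorem rateInputs_rRec₁₁_iff {F : T4Family} (D : Datum F N) (g₀ : ℕ → ℝ) (os : List (ULoop F)) :
    RateInputs (RRec₁₁ 𝔯) F D g₀ os ↔
      ∃ (h : IsDatumOfRecord₁₁C F N D) (k : ℕ), RatesAt D (rateCarriersOfRecord₁₁ 𝔯 F h.params g₀ os k) := by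
  constructor
  · rintro ⟨R, ⟨h, k, rfl⟩, hr⟩
    exact ⟨h, k, hr⟩
  · rintro ⟨h, k, hr⟩
    exact ⟨_, ⟨h, k, rfl⟩, hr⟩

/-! ## §4 K4's existence stub PROVED at the home; the K0 link; honesty -/

/-- **`S_R00x` AT THE HOME, PROVED OUTRIGHT**: at every Stage-11 record the rate carriers of record EXIST under the pins for every tuned run and loop string — witness
the run-length-`0` bundle at the record's own datum key (thresholds trivial, `ForSmallCouplings.of_forall`).  Existence is FREE because the objects are residual
(located, not content). -/
theorem s_R00x_rRec₁₁ : S_R00x (fun F D w => IsRecordOfRecord₁₁C F N D w) (RRec₁₁ 𝔯) := by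
  intro F D w hR _ _
  obtain ⟨h, hall⟩ := exists_rRec₁₁_of_isRecordOfRecord₁₁C 𝔯 hR
  exact T4ContinuumYM4Torus.ForSmallCouplings.of_forall fun g₀ os => ⟨_, hall g₀ os 0⟩

/-- **K0 LINK, positive side**: under the body of the route's K0 `Record11Inhabited` at `N` the predicate pins, on every family and for every `(g₀, os, k)`, a bundle
at a Stage-11 datum of record. -/
theorem exists_pinned_rRec₁₁_of_inhabited
    (hK0 : ∀ F : T4Family, ∃ (D : Datum F N) (w : DagBinding.WorldP), IsRecordOfRecord₁₁C F N D w)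
    (F : T4Family) (g₀ : ℕ → ℝ) (os : List (ULoop F)) (k : ℕ) :
    ∃ (D : Datum F N) (w : DagBinding.WorldP) (R : RateCarriers N), IsRecordOfRecord₁₁C F N D w ∧ RRec₁₁ 𝔯 F D g₀ os R := by
  obtain ⟨D, w, hR⟩ := hK0 F
  obtain ⟨h, hall⟩ := exists_rRec₁₁_of_isRecordOfRecord₁₁C 𝔯 hR
  exact ⟨D, w, _, hR, hall g₀ os k⟩

/-- **HONESTY — located vacuity**: if NO datum of record exists at `N` on any family (the negation of K0's body), the six antitone K4 stubs hold at `RRec₁₁ 𝔯` WITH NO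
ESTIMATE; the ₁₁ knit of the NE-side is worth exactly K0 (`S_R00x` is the existence side and is proved above regardless). -/
theorem k4_rRec₁₁_of_uninhabited (hno : ∀ (F : T4Family) (D : Datum F N), ¬ IsDatumOfRecord₁₁C F N D) :
    S_N14 (RRec₁₁ 𝔯) ∧ S_N15 (RRec₁₁ 𝔯) ∧ S_N16 (RRec₁₁ 𝔯) ∧ S_N17 (RRec₁₁ 𝔯) ∧ S_N18 (RRec₁₁ 𝔯) ∧ S_N22 (RRec₁₁ 𝔯) ∧ S_D4 (RRec₁₁ 𝔯) := by
  refine ⟨?_, ?_, ?_, ?_, ?_, ?_, ?_⟩ <;>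
  · rintro F D g₀ os R ⟨h, k, -⟩
    exact absurd h (hno F D)

end YMDAG.UVSplit

end
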